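import Summits.HubbardSuperconductivity.HubbardSuperconductivity.Theorems.JosephsonMirrorWindowDouble
import Literature.MathematicalPhysics.QuantumLattice.SectorSpectrum

/-!
# Route `JosephsonMirror` — the Josephson energy: variational structure in the coupling

Helper file for the crux stmt-HubbardSuperconductivity-2227 (`JmInterchange`) of route
`JosephsonMirror` (sub-problem `HubbardSuperconductivity`): the elementary convex-analysis toolkit
for the window energy `E(J) = minEnergyOn (H(J)) S` of the window double
`H(J) = H₀ - J K`, `H₀ = A ⊗ 1 + 1 ⊗ Aᵀ`, `K = D ⊗ D̄ + Dᴴ ⊗ D̄ᴴ`, on any subspace `S`: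

* `re_rayleigh_windowDouble`: `Re ⟨ψ, H(J) ψ⟩ = Re ⟨ψ, H₀ ψ⟩ - J · Re ⟨ψ, K ψ⟩`;
* `minEnergyOn_windowDouble_le`: the variational bound `E(J) ≤ Re ⟨ψ, H₀ ψ⟩ - J Re ⟨ψ, K ψ⟩`;
* the two-sided **Feynman–Hellmann sandwich**: for a minimiser `ψ_J` of the `J`-problem
  `E(0) - E(J) ≤ J Re ⟨ψ_J, K ψ_J⟩` (`sub_le_of_isMinimiser`), and for a minimiser `ψ₀` of the
  `J = 0` problem `J Re ⟨ψ₀, K ψ₀⟩ ≤ E(0) - E(J)` (`le_sub_of_isMinimiser_zero`);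
* `minEnergyOn_windowDouble_concaveOn`: `J ↦ E(J)` is concave (an infimum of affine functions).

Sources: T. Koma, H. Tasaki, J. Stat. Phys. 76 (1994) 745 (the two-sided bounds in the SSB ⇔ LRO
discussion); H. Tasaki, *Physics and Mathematics of Quantum Many-Body Systems* (2020) §2.1
(variational principle). No new definitions.
-/

-- the mandated namespace `Summit.<Summit>.<Problem>.Theorems` repeats `HubbardSuperconductivity`
-- (single-problem summit, D-0017), which the `dupNamespace` linter flags on every declaration
set_option linter.dupNamespace false

namespace Summit.HubbardSuperconductivity.HubbardSuperconductivity.Theorems.JosephsonMirror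

open Matrix Literature.MathematicalPhysics.QuantumLattice
open scoped Kronecker ComplexOrder

variable {ι : Type*} [Fintype ι] [DecidableEq ι]

/-- The Rayleigh quotient of the window double splits affinely in the coupling:
`Re ⟨ψ, (H₀ - J K) ψ⟩ = Re ⟨ψ, H₀ ψ⟩ - J Re ⟨ψ, K ψ⟩`. [folklore] -/
theorem re_rayleigh_windowDouble (A D : Matrix ι ι ℂ) (J : ℝ) (ψ : ι × ι → ℂ) :
    (star ψ ⬝ᵥ (A ⊗ₖ (1 : Matrix ι ι ℂ) + (1 : Matrix ι ι ℂ) ⊗ₖ Aᵀ -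
        (J : ℂ) • (D ⊗ₖ Dᴴᵀ + Dᴴ ⊗ₖ Dᵀ)) *ᵥ ψ).re =
      (star ψ ⬝ᵥ (A ⊗ₖ (1 : Matrix ι ι ℂ) + (1 : Matrix ι ι ℂ) ⊗ₖ Aᵀ) *ᵥ ψ).re -
        J * (star ψ ⬝ᵥ (D ⊗ₖ Dᴴᵀ + Dᴴ ⊗ₖ Dᵀ) *ᵥ ψ).re := by
  rw [sub_mulVec, smul_mulVec, dotProduct_sub, dotProduct_smul, smul_eq_mul, Complex.sub_re,
    Complex.re_ofReal_mul]

/-- **Variational bound**: for a unit vector `ψ ∈ S`,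
`E(J) ≤ Re ⟨ψ, H₀ ψ⟩ - J Re ⟨ψ, K ψ⟩`. Tasaki (2020) §2.1. [folklore] -/
theorem minEnergyOn_windowDouble_le {A : Matrix ι ι ℂ} (hA : A.IsHermitian) (D : Matrix ι ι ℂ)
    (J : ℝ) (S : Submodule ℂ (ι × ι → ℂ)) {ψ : ι × ι → ℂ} (hψ : ψ ∈ S) (h1 : star ψ ⬝ᵥ ψ = 1) :
    (A ⊗ₖ (1 : Matrix ι ι ℂ) + (1 : Matrix ι ι ℂ) ⊗ₖ Aᵀ -
        (J : ℂ) • (D ⊗ₖ Dᴴᵀ + Dᴴ ⊗ₖ Dᵀ)).minEnergyOn S ≤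
      (star ψ ⬝ᵥ (A ⊗ₖ (1 : Matrix ι ι ℂ) + (1 : Matrix ι ι ℂ) ⊗ₖ Aᵀ) *ᵥ ψ).re -
        J * (star ψ ⬝ᵥ (D ⊗ₖ Dᴴᵀ + Dᴴ ⊗ₖ Dᵀ) *ᵥ ψ).re := by
  rw [← re_rayleigh_windowDouble]
  exact minEnergyOn_le_rayleigh_of_mem (isHermitian_windowDouble hA D J) S hψ h1

/-- **Feynman–Hellmann, upper half**: if the unit vector `ψ ∈ S` attains `E(J)`, then
`E(0) - E(J) ≤ J · Re ⟨ψ, K ψ⟩` (test the `J = 0` problem with `ψ`). Koma–Tasaki, J. Stat. Phys.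
76 (1994) 745. [folklore] -/
theorem sub_le_of_isMinimiser {A : Matrix ι ι ℂ} (hA : A.IsHermitian) (D : Matrix ι ι ℂ)
    (J : ℝ) (S : Submodule ℂ (ι × ι → ℂ)) {ψ : ι × ι → ℂ} (hψ : ψ ∈ S) (h1 : star ψ ⬝ᵥ ψ = 1)
    (hmin : (star ψ ⬝ᵥ (A ⊗ₖ (1 : Matrix ι ι ℂ) + (1 : Matrix ι ι ℂ) ⊗ₖ Aᵀ -
        (J : ℂ) • (D ⊗ₖ Dᴴᵀ + Dᴴ ⊗ₖ Dᵀ)) *ᵥ ψ).re =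
      (A ⊗ₖ (1 : Matrix ι ι ℂ) + (1 : Matrix ι ι ℂ) ⊗ₖ Aᵀ -
        (J : ℂ) • (D ⊗ₖ Dᴴᵀ + Dᴴ ⊗ₖ Dᵀ)).minEnergyOn S) :
    (A ⊗ₖ (1 : Matrix ι ι ℂ) + (1 : Matrix ι ι ℂ) ⊗ₖ Aᵀ -
          ((0 : ℝ) : ℂ) • (D ⊗ₖ Dᴴᵀ + Dᴴ ⊗ₖ Dᵀ)).minEnergyOn S -
        (A ⊗ₖ (1 : Matrix ι ι ℂ) + (1 : Matrix ι ι ℂ) ⊗ₖ Aᵀ -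
          (J : ℂ) • (D ⊗ₖ Dᴴᵀ + Dᴴ ⊗ₖ Dᵀ)).minEnergyOn S ≤
      J * (star ψ ⬝ᵥ (D ⊗ₖ Dᴴᵀ + Dᴴ ⊗ₖ Dᵀ) *ᵥ ψ).re := by
  have h0 := minEnergyOn_windowDouble_le hA D 0 S hψ h1
  rw [re_rayleigh_windowDouble] at hmin
  rw [zero_mul, sub_zero] at h0
  linarith

/-- **Feynman–Hellmann, lower half**: if the unit vector `ψ ∈ S` attains `E(0)`, then
`J · Re ⟨ψ, K ψ⟩ ≤ E(0) - E(J)` (test the `J`-problem with `ψ`; first-order perturbation bound on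
the degenerate `J = 0` ground floor). Koma–Tasaki, J. Stat. Phys. 76 (1994) 745. [folklore] -/
theorem le_sub_of_isMinimiser_zero {A : Matrix ι ι ℂ} (hA : A.IsHermitian) (D : Matrix ι ι ℂ)
    (J : ℝ) (S : Submodule ℂ (ι × ι → ℂ)) {ψ : ι × ι → ℂ} (hψ : ψ ∈ S) (h1 : star ψ ⬝ᵥ ψ = 1)
    (hmin : (star ψ ⬝ᵥ (A ⊗ₖ (1 : Matrix ι ι ℂ) + (1 : Matrix ι ι ℂ) ⊗ₖ Aᵀ -
        ((0 : ℝ) : ℂ) • (D ⊗ₖ Dᴴᵀ + Dᴴ ⊗ₖ Dᵀ)) *ᵥ ψ).re =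
      (A ⊗ₖ (1 : Matrix ι ι ℂ) + (1 : Matrix ι ι ℂ) ⊗ₖ Aᵀ -
        ((0 : ℝ) : ℂ) • (D ⊗ₖ Dᴴᵀ + Dᴴ ⊗ₖ Dᵀ)).minEnergyOn S) :
    J * (star ψ ⬝ᵥ (D ⊗ₖ Dᴴᵀ + Dᴴ ⊗ₖ Dᵀ) *ᵥ ψ).re ≤
      (A ⊗ₖ (1 : Matrix ι ι ℂ) + (1 : Matrix ι ι ℂ) ⊗ₖ Aᵀ -
          ((0 : ℝ) : ℂ) • (D ⊗ₖ Dᴴᵀ + Dᴴ ⊗ₖ Dᵀ)).minEnergyOn S -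
        (A ⊗ₖ (1 : Matrix ι ι ℂ) + (1 : Matrix ι ι ℂ) ⊗ₖ Aᵀ -
          (J : ℂ) • (D ⊗ₖ Dᴴᵀ + Dᴴ ⊗ₖ Dᵀ)).minEnergyOn S := by
  have hJ := minEnergyOn_windowDouble_le hA D J S hψ h1
  rw [re_rayleigh_windowDouble, zero_mul, sub_zero] at hmin
  linarith

/-- **Concavity of the Josephson energy**: on a nonzero subspace `S`, `J ↦ E(J)` is concave on
`ℝ` — an infimum (over the unit vectors of `S`) of the affine functions
`J ↦ Re ⟨ψ, H₀ ψ⟩ - J Re ⟨ψ, K ψ⟩`. Koma–Tasaki, J. Stat. Phys. 76 (1994) 745 (concavity of the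
ground-state energy in a source). [folklore] -/
theorem minEnergyOn_windowDouble_concaveOn {A : Matrix ι ι ℂ} (hA : A.IsHermitian)
    (D : Matrix ι ι ℂ) {S : Submodule ℂ (ι × ι → ℂ)} (hS : S ≠ ⊥) :
    ConcaveOn ℝ Set.univ (fun J : ℝ =>
      (A ⊗ₖ (1 : Matrix ι ι ℂ) + (1 : Matrix ι ι ℂ) ⊗ₖ Aᵀ -
        (J : ℂ) • (D ⊗ₖ Dᴴᵀ + Dᴴ ⊗ₖ Dᵀ)).minEnergyOn S) := by
  refine ⟨convex_univ, fun x _ y _ a b ha hb hab => ?_⟩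
  obtain ⟨v, hvS, hv0⟩ := (Submodule.ne_bot_iff S).1 hS
  obtain ⟨c, -, hc1⟩ := exists_smul_unit hv0
  have hne : ∃ ψ ∈ S, star ψ ⬝ᵥ ψ = 1 := ⟨c • v, S.smul_mem c hvS, hc1⟩
  simp only [smul_eq_mul]
  refine le_csInf ?_ ?_
  · obtain ⟨ψ, hψ, h1⟩ := hne
    exact ⟨_, ψ, hψ, h1, rfl⟩
  · rintro E ⟨ψ, hψ, h1, rfl⟩
    have hx := minEnergyOn_windowDouble_le hA D x S hψ h1
    have hy := minEnergyOn_windowDouble_le hA D y S hψ h1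
    rw [re_rayleigh_windowDouble]
    have key : a * ((star ψ ⬝ᵥ (A ⊗ₖ (1 : Matrix ι ι ℂ) + (1 : Matrix ι ι ℂ) ⊗ₖ Aᵀ) *ᵥ ψ).re -
          x * (star ψ ⬝ᵥ (D ⊗ₖ Dᴴᵀ + Dᴴ ⊗ₖ Dᵀ) *ᵥ ψ).re) +
        b * ((star ψ ⬝ᵥ (A ⊗ₖ (1 : Matrix ι ι ℂ) + (1 : Matrix ι ι ℂ) ⊗ₖ Aᵀ) *ᵥ ψ).re -
          y * (star ψ ⬝ᵥ (D ⊗ₖ Dᴴᵀ + Dᴴ ⊗ₖ Dᵀ) *ᵥ ψ).re) =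
        (star ψ ⬝ᵥ (A ⊗ₖ (1 : Matrix ι ι ℂ) + (1 : Matrix ι ι ℂ) ⊗ₖ Aᵀ) *ᵥ ψ).re -
          (a * x + b * y) * (star ψ ⬝ᵥ (D ⊗ₖ Dᴴᵀ + Dᴴ ⊗ₖ Dᵀ) *ᵥ ψ).re := by
      have : a * (star ψ ⬝ᵥ (A ⊗ₖ (1 : Matrix ι ι ℂ) + (1 : Matrix ι ι ℂ) ⊗ₖ Aᵀ) *ᵥ ψ).re +
          b * (star ψ ⬝ᵥ (A ⊗ₖ (1 : Matrix ι ι ℂ) + (1 : Matrix ι ι ℂ) ⊗ₖ Aᵀ) *ᵥ ψ).re =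
          (star ψ ⬝ᵥ (A ⊗ₖ (1 : Matrix ι ι ℂ) + (1 : Matrix ι ι ℂ) ⊗ₖ Aᵀ) *ᵥ ψ).re := by
        rw [← add_mul, hab, one_mul]
      linear_combination this
    rw [← key]
    nlinarith [mul_le_mul_of_nonneg_left hx ha, mul_le_mul_of_nonneg_left hy hb]

end Summit.HubbardSuperconductivity.HubbardSuperconductivity.Theorems.JosephsonMirror
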